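import Literature.NumberTheory.Automorphic.LieAlgebraGLExponential
import Literature.Geometry.Kaehler.ComplexTorusHodgeGroupSymplecticGramLieSimple
import Literature.Geometry.Kaehler.ComplexTorusHodgeLieAlgebraSymplecticDimension
import HarnessLib

/-!
# The analytic Lie algebra of `Hg(X)(ℂ)` is the algebraic one: `hodgeGroupComplexLie = Lie(Hg(X)(ℂ))`,
# `𝔥𝔤_ℂ = {Z | e^{tZ} ∈ Hg(X)(ℂ), t ∈ ℝ}` for EVERY complex torus, and `dim_ℝ 𝔥𝔤_ℝ = dim Hg(X)`

Layer `Literature/Geometry/Kaehler`, namespace `Literature.Geometry.Kaehler.ComplexTorus`; lane `lit-hodgefound`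
(Track 2 foundations library), Layer A4; prover seat `lit-hodgefound-p17` (generation 39, self-proposed row g39-#9b).
The lane carries two Lie algebras of the Hodge group: the ANALYTIC ones of `ComplexTorusHodgeGroupLieAlgebraCartan` ∕
`…RealForms` (`hodgeGroupLieC Φ = {Z | e^{tZ} ∈ Hg(X)(ℂ) for all real t}` (Hall ∕ Mostow), its real form `hodgeGroupLie Φ = 𝔥𝔤_ℝ`,
and the complex Lie subalgebra `hodgeGroupComplexLie Φ = {Z | e^{zZ} ∈ Hg(X)(ℂ) for all complex z}`), and the ALGEBRAIC one
of the trunk (`lieAlgebraGL ∕ lieSubalgebraGL (Hg(X)(ℂ))`, Springer 4.4), with its dimension theory (`zdim = dim Hg(X)`,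
`IsZConnected.finrank_lieAlgebraGL_eq`). So far the analytic and the algebraic ones were related only for nilpotent elements
(`mem_hodgeGroupLieC_of_isNilpotent_of_mem_lieAlgebraGL`). THIS FILE applies Goodman–Wallach's Theorem 1.4.10, proved for every complex
algebraic group in g39-#9a (`LieAlgebraGLExponential`), to `G = Hg(X)(ℂ)`:

* §1 **`hodgeGroupComplexLie_eq_lieSubalgebraGL`** (`hodgeGroupComplexLie Φ = lieSubalgebraGL (Hg(X)(ℂ))`),
  `mem_hodgeGroupComplexLie_iff_mem_lieAlgebraGL`, `mem_hodgeGroupLieC_iff_mem_lieAlgebraGL`,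
  **`coe_hodgeGroupLieC_eq_coe_lieAlgebraGL`** (every complex torus; the equality of the two ANALYTIC algebras
  `hodgeGroupComplexLie = hodgeGroupLieC` for every torus is p17's `ComplexTorusHodgeGroupRealPointsDense`, by the printed
  analytic proof — not restated);
* §2 **`finrank_hodgeGroupComplexLie_eq_zdim`**, **`finrank_hodgeGroupLie_eq_zdim`** (`dim_ℝ 𝔥𝔤_ℝ = dim_ℂ 𝔥𝔤_ℂ = dim Hg(X)`),
  `zdim_hodgeGroupC_eq_iff_finrank_hodgeGroupLie_eq`;
* §3 transfer of simplicity ∕ commutativity: `isSimple_hodgeGroupComplexLie_iff`, `isLieAbelian_hodgeGroupComplexLie_iff`, so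
  that the Lie-simplicity hypothesis of the product theorems (`…_of_isSimple_lieSubalgebraGL`) may be checked on `𝔥𝔤_ℂ`.

THEOREMS ONLY (no definition, no instance, no named fact; net debt 0).

## Sources

* R. Goodman, N. R. Wallach [GoodmanWallachGTM255], §1.4.4 Theorem 1.4.10: for an algebraic `G ≤ GL(n, ℂ)`,
  `{A | exp(tA) ∈ G for all t ∈ ℝ}` is the Lie algebra of `G` as an algebraic group; §1.7.1 (1.61).
* M. Green, P. Griffiths, M. Kerr [GreenGriffithsKerr2012], §II.A (p. 46): `𝔤_ℂ = Lie M_φ(ℂ)`.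
* T. A. Springer [Springer1998], 4.4.5–4.4.10 (the Lie algebra of a linear algebraic group), 1.8.1 (dimension).

## References

* [GoodmanWallachGTM255] R. Goodman, N. R. Wallach, *Symmetry, Representations, and Invariants*, GTM 255 (2009), §1.4.4
  Thm. 1.4.10, §1.7.1.
* [GreenGriffithsKerr2012] M. Green, P. Griffiths, M. Kerr, *Mumford–Tate Groups and Domains*, Princeton (2012), §II.A.
* [Springer1998] T. A. Springer, *Linear Algebraic Groups*, 2nd ed. (1998), 4.4.5–4.4.10, 1.8.1.
-/

noncomputable section

open Matrix Module NormedSpace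

namespace Literature.Geometry.Kaehler

namespace ComplexTorus

open Literature.NumberTheory.Automorphic (IsZConnected lieAlgebraGL lieSubalgebraGL)

variable {ι : Type*} [Fintype ι] [DecidableEq ι] {E : Type*} [NormedAddCommGroup E] [NormedSpace ℂ E]
  (Φ : (ι → ℝ) ≃L[ℝ] E)

/-! ## §1 `hodgeGroupComplexLie = Lie(Hg(X)(ℂ))` and `hodgeGroupLieC = Lie(Hg(X)(ℂ))` as sets -/

/-- `∃ M ∈ Hg(X)(ℂ), M = A` iff `∃ g ∈ Hg(X)(ℂ) ≤ GL(V_ℂ), g = A`. [folklore] -/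
private theorem exists_mem_hodgeGroupC_coe_eq_iff {A : Matrix ι ι ℂ} :
    (∃ M ∈ hodgeGroupC Φ, (M : Matrix ι ι ℂ) = A) ↔
      ∃ g ∈ (hodgeGroupC Φ).map Matrix.SpecialLinearGroup.toGL, ((g : GL ι ℂ) : Matrix ι ι ℂ) = A := by
  constructor
  · rintro ⟨M, hM, hMA⟩
    exact ⟨Matrix.SpecialLinearGroup.toGL M, Subgroup.mem_map_of_mem _ hM, by
      rw [Matrix.SpecialLinearGroup.coe_GL_coe_matrix, hMA]⟩
  · rintro ⟨g, hg, hgA⟩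
    obtain ⟨M, hM, rfl⟩ := Subgroup.mem_map.1 hg
    exact ⟨M, hM, by rw [← hgA, Matrix.SpecialLinearGroup.coe_GL_coe_matrix]⟩

/-- **`Z ∈ 𝔥𝔤_ℂ ⟺ Z ∈ Lie(Hg(X)(ℂ))`** (Goodman–Wallach 1.4.10 for `G = Hg(X)(ℂ)`, complex one-parameter subgroups).
[cite: GoodmanWallachGTM255, §1.4.4 Theorem 1.4.10] [cite: GreenGriffithsKerr2012, §II.A (p. 46)] -/
theorem mem_hodgeGroupComplexLie_iff_mem_lieAlgebraGL {Z : Matrix ι ι ℂ} :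
    Z ∈ hodgeGroupComplexLie Φ ↔ Z ∈ lieAlgebraGL ((hodgeGroupC Φ).map Matrix.SpecialLinearGroup.toGL) := by
  rw [mem_hodgeGroupComplexLie_iff,
    Literature.NumberTheory.Automorphic.mem_lieAlgebraGL_iff_forall_exp_smul_mem (isAlgebraicSubgroup_map_toGL_hodgeGroupC Φ)]
  exact forall_congr' fun z ↦ exists_mem_hodgeGroupC_coe_eq_iff Φ

/-- **`Z ∈ hodgeGroupLieC ⟺ Z ∈ Lie(Hg(X)(ℂ))`** (Goodman–Wallach 1.4.10 verbatim: real one-parameter subgroups).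
[cite: GoodmanWallachGTM255, §1.4.4 Theorem 1.4.10] -/
theorem mem_hodgeGroupLieC_iff_mem_lieAlgebraGL {Z : Matrix ι ι ℂ} :
    Z ∈ hodgeGroupLieC Φ ↔ Z ∈ lieAlgebraGL ((hodgeGroupC Φ).map Matrix.SpecialLinearGroup.toGL) := by
  rw [mem_hodgeGroupLieC_iff,
    Literature.NumberTheory.Automorphic.mem_lieAlgebraGL_iff_forall_real_exp_smul_mem (isAlgebraicSubgroup_map_toGL_hodgeGroupC Φ)]
  refine forall_congr' fun t ↦ ?_
  rw [Complex.coe_smul]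
  exact exists_mem_hodgeGroupC_coe_eq_iff Φ

/-- **`hodgeGroupComplexLie Φ = lieSubalgebraGL (Hg(X)(ℂ))`**: the analytic complex Lie algebra of the Hodge group is the
algebraic one. [cite: GoodmanWallachGTM255, §1.4.4 Theorem 1.4.10] [cite: GreenGriffithsKerr2012, §II.A (p. 46)] -/
theorem hodgeGroupComplexLie_eq_lieSubalgebraGL :
    hodgeGroupComplexLie Φ = lieSubalgebraGL ((hodgeGroupC Φ).map Matrix.SpecialLinearGroup.toGL) := by
  letI : LieRing (Matrix ι ι ℂ) := LieRing.ofAssociativeRing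
  letI : LieAlgebra ℂ (Matrix ι ι ℂ) := LieAlgebra.ofAssociativeAlgebra
  exact LieSubalgebra.ext _ _ fun _ ↦ mem_hodgeGroupComplexLie_iff_mem_lieAlgebraGL Φ

/-- Carrier form: `hodgeGroupComplexLie Φ = Lie(Hg(X)(ℂ))` as sets. [cite: GoodmanWallachGTM255, §1.4.4 Theorem 1.4.10] -/
theorem coe_hodgeGroupComplexLie_eq_coe_lieAlgebraGL :
    (hodgeGroupComplexLie Φ : Set (Matrix ι ι ℂ)) = lieAlgebraGL ((hodgeGroupC Φ).map Matrix.SpecialLinearGroup.toGL) :=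
  Set.ext fun _ ↦ mem_hodgeGroupComplexLie_iff_mem_lieAlgebraGL Φ

/-- **`hodgeGroupLieC Φ = Lie(Hg(X)(ℂ))` as sets.** [cite: GoodmanWallachGTM255, §1.4.4 Theorem 1.4.10] -/
theorem coe_hodgeGroupLieC_eq_coe_lieAlgebraGL :
    (hodgeGroupLieC Φ : Set (Matrix ι ι ℂ)) = lieAlgebraGL ((hodgeGroupC Φ).map Matrix.SpecialLinearGroup.toGL) :=
  Set.ext fun _ ↦ mem_hodgeGroupLieC_iff_mem_lieAlgebraGL Φ

/-! ## §2 `dim_ℝ 𝔥𝔤_ℝ = dim_ℂ 𝔥𝔤_ℂ = dim Hg(X)` -/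

/-- **`dim_ℂ 𝔥𝔤_ℂ = dim Hg(X)`** (the trunk's `zdim` of the Zariski-connected `Hg(X)(ℂ)`): the dimension of an irreducible
algebraic group is that of its Lie algebra. [cite: Springer1998, 4.4.5–4.4.8 with 1.8.1] [cite: GoodmanWallachGTM255, §1.4.4 Theorem 1.4.10] -/
theorem finrank_hodgeGroupComplexLie_eq_zdim :
    finrank ℂ (hodgeGroupComplexLie Φ) = (isZConnected_map_toGL_hodgeGroupC Φ).zdim := by
  letI : LieRing (Matrix ι ι ℂ) := LieRing.ofAssociativeRing
  letI : LieAlgebra ℂ (Matrix ι ι ℂ) := LieAlgebra.ofAssociativeAlgebra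
  have h : (hodgeGroupComplexLie Φ).toSubmodule = lieAlgebraGL ((hodgeGroupC Φ).map Matrix.SpecialLinearGroup.toGL) :=
    Submodule.ext fun _ ↦ mem_hodgeGroupComplexLie_iff_mem_lieAlgebraGL Φ
  change finrank ℂ (hodgeGroupComplexLie Φ).toSubmodule = _
  rw [h, (isZConnected_map_toGL_hodgeGroupC Φ).finrank_lieAlgebraGL_eq.2]

/-- **`dim_ℝ 𝔥𝔤_ℝ = dim Hg(X)`.** [cite: GoodmanWallachGTM255, §1.4.4 Theorem 1.4.10 and §1.7.1 (1.61)] [cite: Springer1998, 1.8.1] -/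
theorem finrank_hodgeGroupLie_eq_zdim :
    finrank ℝ (hodgeGroupLie Φ) = (isZConnected_map_toGL_hodgeGroupC Φ).zdim := by
  rw [← finrank_hodgeGroupComplexLie_eq_finrank_hodgeGroupLie, finrank_hodgeGroupComplexLie_eq_zdim]

/-- `dim Hg(X) = m ⟺ dim_ℝ 𝔥𝔤_ℝ = m` (for every complex torus; the polarised case was
`IsRiemannForm.zdim_map_toGL_hodgeGroupC_eq_iff_finrank_hodgeGroupLie_eq`). [cite: GoodmanWallachGTM255, §1.4.4 Theorem 1.4.10] -/
theorem zdim_hodgeGroupC_eq_iff_finrank_hodgeGroupLie_eq {m : ℕ} :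
    (isZConnected_map_toGL_hodgeGroupC Φ).zdim = m ↔ finrank ℝ (hodgeGroupLie Φ) = m := by
  rw [finrank_hodgeGroupLie_eq_zdim]

/-- `dim_ℂ Lie(Hg(X)(ℂ)) = dim_ℝ 𝔥𝔤_ℝ` (the trunk's `lieAlgebraGL`). [cite: GoodmanWallachGTM255, §1.4.4 Theorem 1.4.10] -/
theorem finrank_lieAlgebraGL_hodgeGroupC_eq_finrank_hodgeGroupLie :
    finrank ℂ (lieAlgebraGL ((hodgeGroupC Φ).map Matrix.SpecialLinearGroup.toGL)) = finrank ℝ (hodgeGroupLie Φ) := by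
  rw [finrank_hodgeGroupLie_eq_zdim, (isZConnected_map_toGL_hodgeGroupC Φ).finrank_lieAlgebraGL_eq.2]

/-! ## §3 Simplicity and commutativity transfer between `𝔥𝔤_ℂ` and `Lie(Hg(X)(ℂ))` -/

/-- **`𝔥𝔤_ℂ` is simple iff `Lie(Hg(X)(ℂ))` is** (they are equal Lie subalgebras of `𝔤𝔩(V_ℂ)`); this makes the hypothesis
of the product theorems `…_of_isSimple_lieSubalgebraGL` checkable on the analytic Lie algebra. [cite: GoodmanWallachGTM255, §1.4.4 Theorem 1.4.10] -/
theorem isSimple_hodgeGroupComplexLie_iff :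
    LieAlgebra.IsSimple ℂ (hodgeGroupComplexLie Φ) ↔
      LieAlgebra.IsSimple ℂ (lieSubalgebraGL ((hodgeGroupC Φ).map Matrix.SpecialLinearGroup.toGL)) := by
  rw [hodgeGroupComplexLie_eq_lieSubalgebraGL]

/-- `𝔥𝔤_ℂ` is abelian iff `Lie(Hg(X)(ℂ))` is. [cite: GoodmanWallachGTM255, §1.4.4 Theorem 1.4.10] -/
theorem isLieAbelian_hodgeGroupComplexLie_iff :
    IsLieAbelian (hodgeGroupComplexLie Φ) ↔
      IsLieAbelian (lieSubalgebraGL ((hodgeGroupC Φ).map Matrix.SpecialLinearGroup.toGL)) := by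
  rw [hodgeGroupComplexLie_eq_lieSubalgebraGL]

section Product

variable {ι₂ : Type*} [Fintype ι₂] [DecidableEq ι₂] {E₂ : Type*} [NormedAddCommGroup E₂] [NormedSpace ℂ E₂]
  (Φ₂ : (ι₂ → ℝ) ≃L[ℝ] E₂)

/-- **`𝔥𝔤_ℂ(X₁)` simple and `dim_ℝ 𝔥𝔤_ℝ(X₂) < dim_ℝ 𝔥𝔤_ℝ(X₁)` ⟹ `Hg(X₁ × X₂) = Hg(X₁) × Hg(X₂)`** — the dimension route
with both hypotheses on the analytic Lie algebras. [cite: MoonenZarhin1999LowDim, §3 (3.1)] [cite: Gordon1997, §2.16 Proposition]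
[cite: GoodmanWallachGTM255, §1.4.4 Theorem 1.4.10] -/
theorem hodgeGroupC_prod_eq_blockDiagProd_of_isSimple_hodgeGroupComplexLie_of_finrank_hodgeGroupLie_lt
    (hsimple : LieAlgebra.IsSimple ℂ (hodgeGroupComplexLie Φ))
    (hlt : finrank ℝ (hodgeGroupLie Φ₂) < finrank ℝ (hodgeGroupLie Φ)) :
    hodgeGroupC (prodPeriod Φ Φ₂) = blockDiagProd (hodgeGroupC Φ) (hodgeGroupC Φ₂) :=
  hodgeGroupC_prod_eq_blockDiagProd_of_isSimple_lieSubalgebraGL_of_zdim_lt Φ Φ₂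
    ((isSimple_hodgeGroupComplexLie_iff Φ).1 hsimple)
    (by rwa [finrank_hodgeGroupLie_eq_zdim, finrank_hodgeGroupLie_eq_zdim] at hlt)

/-- `𝔥𝔤_ℂ(X₁)` simple and `Hg(X₂)(ℂ)` solvable ⟹ `Hg(X₁ × X₂) = Hg(X₁) × Hg(X₂)`. [cite: Gordon1997, §2.16 Proposition and §3 Theorem, proof]
[cite: GoodmanWallachGTM255, §1.4.4 Theorem 1.4.10] -/
theorem hodgeGroupC_prod_eq_blockDiagProd_of_isSimple_hodgeGroupComplexLie_of_isSolvable
    (hsimple : LieAlgebra.IsSimple ℂ (hodgeGroupComplexLie Φ)) (h₂ : IsSolvable ↥(hodgeGroupC Φ₂)) :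
    hodgeGroupC (prodPeriod Φ Φ₂) = blockDiagProd (hodgeGroupC Φ) (hodgeGroupC Φ₂) :=
  hodgeGroupC_prod_eq_blockDiagProd_of_isSimple_lieSubalgebraGL_of_isSolvable Φ Φ₂
    ((isSimple_hodgeGroupComplexLie_iff Φ).1 hsimple) h₂

end Product

end ComplexTorus

end Literature.Geometry.Kaehler

end
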